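import Literature.Barriers.PneNP.PerfectMatchingExtensionComplexity
import Literature.Barriers.PneNP.PMPolytopeEdmondsDescription
import Literature.Combinatorics.Optimization.MatchingPolytopeRelaxationScheme
import Literature.Combinatorics.Optimization.MatchingPolytopeApproximationRestriction
import Literature.Combinatorics.Optimization.PsdLiftProductsAndSums
import HarnessLib

/-!
# The matching polytope has exponential extension complexity: `P_PM(K_n)` is a face of `P_M(K_n)`
# (Rothvoß 2017, §1: "Since `P_PM` is a face of `P_M`, we have `xc(P_PM) ≤ xc(P_M)`")

T. Rothvoß, *The matching polytope has exponential extension complexity*, J. ACM 64 (2017) =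
arXiv:1311.2369 [Rothvoss2017] (held text `paper:arxiv-1311.2369`; locators = PDF pages / lines of
the lit-read materialisation).  §1 (PDF p. 4, L33–40), verbatim:

> "`P_M = conv{χ_M ∈ ℝ^E | M ⊆ E is a matching}`
>  `= {x ∈ ℝ^E | x(δ(v)) ≤ 1 ∀ v ∈ V; x(E(U)) ≤ (|U|−1)/2 ∀ U ⊆ V : |U| odd; x_e ≥ 0 ∀ e ∈ E}`
> is the convex hull of all matchings in `G` (not just the perfect ones). Here, `E(U)` denotes the
> edges running inside of `U`. Since `P_PM` is a face of `P_M`, we have `xc(P_PM) ≤ xc(P_M)`."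

and Theorem 1 (PDF p. 4, L51): "For all even `n`, the extension complexity of the perfect matching
polytope in the complete `n`-node graph is `2^{Ω(n)}`" — a tree THEOREM,
`Rothvoss2017_thm1` (`PerfectMatchingExtensionComplexity.lean`), for `pmPolytope n`.  The title
statement of the paper — the bound for the MATCHING polytope `P_M(K_n)` — follows from the quoted
face relation; this file PROVES it (no named facts) in the tree's currency: `P_M(K_n)` is Edmonds'
polyhedron `StephenTuncel1999.edmondsPolytope (⊤ : SimpleGraph (Fin n))` (the quoted H-description;
`= conv(matching vectors)` is Edmonds' theorem, PROVED in `EdmondsMatchingPolytope.lean`),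
`P_PM(K_n) = pmPolytope n` (`TSPExtensionComplexityPMPolytope.lean`, with Edmonds' description
`mem_pmPolytope_iff` PROVED in `PMPolytopeEdmondsDescription.lean`), extension complexity `≤ r` is
`HasEFOfSize · r`.

* `sum_degree_eq` — the double count `Σ_{v ∈ U} x(δ(v)) = 2·x(E(U)) − oddCutVec U · x`
  (`= 2·x(E(U)) + x(δ(U))`), and `sum_degree_univ` (`Σ_v x(δ(v)) = 2·Σ_e x_e`);
* **`pmPolytope_eq_edmondsPolytope_inter`** — THE FACE: `P_PM(K_n) = P_M(K_n) ∩ {x | Σ_e x_e = n/2}`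
  (valid for every `n`; for odd `n` both sides are empty), read off the two Edmonds descriptions:
  on `P_PM` the degree equations give `Σ_e x_e = n/2` and, with `x(δ(U)) ≥ 1`, the blossom
  inequalities `x(E(U)) ≤ (|U|−1)/2`; conversely `Σ_e x_e = n/2` forces all degree constraints of
  `P_M` to be tight, and then the blossom inequality of an odd `U` gives `x(δ(U)) ≥ 1`;
  `sum_le_half_of_mem_edmondsPolytope` (`Σ_e x_e ≤ n/2` is valid on `P_M`, so this IS a face);
* **`HasEFOfSize.pmPolytope_of_edmondsPolytope`** — "`xc(P_PM) ≤ xc(P_M)`": an extended formulation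
  of `P_M(K_n)` of size `r` gives one of `P_PM(K_n)` of size `r` (`HasEFOfSize.inter_eqs`);
* **`Rothvoss2017_thm1_matchingPolytope`** — the title theorem: there is `c > 0` such that for all
  large even `n` every extended formulation of `P_M(K_n)` has at least `2^{cn}` inequalities
  (`Rothvoss2017_thm1` through the face), and its nonnegative-rank reading
  `hasNonnegFactorization_pmOddCutSlack_of_hasEF_edmondsPolytope` (an EF of `P_M(K_n)` of size `r`
  factorises the odd-cut slack matrix of `P_PM(K_n)` through `r + 1` nonnegative coordinates).
  (Monotonicity in the graph, `xc(P_M(H)) ≤ xc(P_M(G))` for `H ≤ G`, is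
  `hasEFOfSize_edmondsPolytope_of_subgraph` in `MatchingPolytopeApproximationRestriction.lean`.)
* (appended) **all large `n`**: the transport of `edmondsPolytope` along a vertex EMBEDDING
  `f : V ↪ W` — `mapEdgeEquiv f : E(G) ≃ E(G.map f)`, `mem_edmondsPolytope_map_iff`
  (`y ∈ P_M(G.map f) ↔ y ∘ f ∈ P_M(G)`: `G.map f` is a copy of `G` plus isolated vertices),
  `hasEFOfSize_edmondsPolytope_map_iff` — then `hasEFOfSize_edmondsPolytope_top_of_succ`
  (`xc(P_M(K_m)) ≤ xc(P_M(K_{m+1}))`, via `K_m ⊆ K_{m+1}` and the subgraph monotonicity) and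
  **`Rothvoss2017_thm1_matchingPolytope_all`**: `∃ c > 0`, for all large `n` (any parity) every
  extended formulation of `P_M(K_n)` has at least `2^{cn}` inequalities.

* (appended, §Psd) **the SEMIDEFINITE versions** — faces and vertex embeddings are free for psd lifts
  too (`HasPsdLift`, GPT 2013 Prop. 2.8 (3) = the tree's `HasPsdLift.inter_setOf_apply_eq`, `.image`):
  `hasPsdLift_pmPolytope_of_edmondsPolytope` (a size-`k` psd lift of `P_M(K_n)` gives one of
  `P_PM(K_n)`), `edmondsPolytope_map_eq_image` / `hasPsdLift_edmondsPolytope_map_iff` (embeddings),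
  `hasPsdLift_edmondsPolytope_top_of_le` / `hasEFOfSize_edmondsPolytope_top_of_le` (`K_m ⊆ K_N`,
  `m ≤ N`), and **`hasPsdLift_pmPolytope_of_edmondsPolytope_ge`**: a psd lift of size `k` of the
  matching polytope of `K_N` yields one of the PERFECT matching polytope of `K_n` for every `n ≤ N` —
  so every lower bound on the semidefinite extension complexity of `P_PM(K_n)` (the object of the
  FGPRT open problem and of this cell, cf. §4.2: "it is still unknown whether there is a polynomial
  size SDP for the perfect matching polytope") is a lower bound for `P_M(K_N)`, `N ≥ n`.

WHAT THIS IS NOT: no lower bound on psd rank / semidefinite extension complexity is proved here (the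
cell's crux); nothing on P versus NP; the LP constants are Rothvoß's slot-model constant (halved once
more for odd `n`), not optimised.

## References

* [FawziEtAl2020] H. Fawzi, J. Gouveia, P. A. Parrilo, J. Saunderson, R. R. Thomas, *Lifting for
  simplicity: concise descriptions of convex sets*, SIAM Review 64 (2022) 866–918, arXiv:2002.09788 — §6
  Discussion (p0030 L47–48: the open question on the semidefinite extension complexity of matchings).
* [Rothvoss2017] T. Rothvoß, *The matching polytope has exponential extension complexity*, J. ACM 64
  (2017) Art. 41, doi:10.1145/3127497, arXiv:1311.2369 — §1 (PDF p. 4, L33–40: `P_M`, "P_PM is a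
  face of P_M"), Thm. 1 (PDF p. 4, L51).
* [Edmonds1965] J. Edmonds, *Maximum matching and a polyhedron with 0,1-vertices*, J. Res. Nat. Bur.
  Standards 69B (1965) 125–130 — §2 (the two descriptions; tree: `EdmondsMatchingPolytope.lean`,
  `PMPolytopeEdmondsDescription.lean`).
* [KorteVygen2018] B. Korte, J. Vygen, *Combinatorial Optimization*, 6th ed., Thms. 11.15–11.16
  (pp. 297–298).
-/

noncomputable section

open Finset Matrix Filter

namespace Literature.Barriers.PneNP

open Literature.Combinatorics.Optimization Literature.Combinatorics.Optimization.StephenTuncel1999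

variable {n : ℕ}

/-! ### Degree sums: the double count `Σ_{v ∈ U} x(δ(v)) = Σ_e |e ∩ U| · x_e` -/

/-- Edges of `K_n` are not loops. [folklore] -/
private theorem not_isDiag_coe (e : EKn n) : ¬ (e : Sym2 (Fin n)).IsDiag := by
  obtain ⟨e, he⟩ := e
  simpa [SimpleGraph.edgeSet_top] using he

/-- `E(U)` in terms of the endpoint count: an edge of `K_n` lies inside `U` iff it has two
endpoints in `U`. [folklore] -/
private theorem mem_edgesIn_iff_cutCount (U : Finset (Fin n)) (e : EKn n) :
    e ∈ edgesIn (⊤ : SimpleGraph (Fin n)) U ↔ cutCount U (e : Sym2 (Fin n)) = 2 := by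
  simp only [edgesIn, Finset.mem_filter, Finset.mem_univ, true_and]
  obtain ⟨e, he⟩ := e
  induction e using Sym2.ind with
  | h a b =>
    simp only [Sym2.mem_iff, forall_eq_or_imp, forall_eq, cutCount_mk]
    by_cases ha : a ∈ U <;> by_cases hb : b ∈ U <;> simp [ha, hb]

/-- **Double counting of degrees**: `Σ_{v ∈ U} x(δ(v)) = Σ_e |e ∩ U| · x_e`. [folklore] -/
private theorem sum_degree_eq_sum_cutCount (x : EKn n → ℝ) (U : Finset (Fin n)) :
    ∑ v ∈ U, ∑ e ∈ univ.filter (fun e : EKn n => v ∈ (e : Sym2 (Fin n))), x e =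
      ∑ e : EKn n, (cutCount U (e : Sym2 (Fin n)) : ℝ) * x e := by
  calc ∑ v ∈ U, ∑ e ∈ univ.filter (fun e : EKn n => v ∈ (e : Sym2 (Fin n))), x e
      = ∑ v ∈ U, ∑ e : EKn n, (if v ∈ (e : Sym2 (Fin n)) then x e else 0) :=
        Finset.sum_congr rfl fun v _ => Finset.sum_filter _ _
    _ = ∑ e : EKn n, ∑ v ∈ U, (if v ∈ (e : Sym2 (Fin n)) then x e else 0) := Finset.sum_comm
    _ = ∑ e : EKn n, (cutCount U (e : Sym2 (Fin n)) : ℝ) * x e := by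
        refine Finset.sum_congr rfl fun e _ => ?_
        rw [← Finset.sum_filter, Finset.sum_const, nsmul_eq_mul,
          card_filter_mem_eq_cutCount U (not_isDiag_coe e)]

/-- `oddCutVec U · x = −x(δ(U))`. [cite: Rothvoss2017, §1 (PDF p. 4)] -/
private theorem oddCutVec_dotProduct (U : Finset (Fin n)) (x : EKn n → ℝ) :
    oddCutVec U ⬝ᵥ x = -∑ e ∈ univ.filter (fun e : EKn n => cutCount U (e : Sym2 (Fin n)) = 1), x e := by
  rw [Finset.sum_filter, dotProduct, ← Finset.sum_neg_distrib]
  refine Finset.sum_congr rfl fun e _ => ?_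
  unfold oddCutVec
  split_ifs <;> simp

/-- **`Σ_{v ∈ U} x(δ(v)) = 2·x(E(U)) + x(δ(U))`**, with `x(δ(U)) = −oddCutVec U · x`: the degree sum
over `U` counts inner edges twice and cut edges once. [cite: KorteVygen2018, Thm. 11.16 proof (p. 298: "|A₁| − 2 Σ_{e ∈ E(G[A])} x_e")] -/
theorem sum_degree_eq (x : EKn n → ℝ) (U : Finset (Fin n)) :
    ∑ v ∈ U, ∑ e ∈ univ.filter (fun e : EKn n => v ∈ (e : Sym2 (Fin n))), x e =
      2 * ∑ e ∈ edgesIn (⊤ : SimpleGraph (Fin n)) U, x e - oddCutVec U ⬝ᵥ x := by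
  rw [sum_degree_eq_sum_cutCount, oddCutVec_dotProduct, sub_neg_eq_add, Finset.sum_filter,
    Finset.mul_sum]
  have hin : ∑ e ∈ edgesIn (⊤ : SimpleGraph (Fin n)) U, 2 * x e =
      ∑ e : EKn n, (if cutCount U (e : Sym2 (Fin n)) = 2 then 2 * x e else 0) := by
    rw [← Finset.sum_filter]
    refine Finset.sum_congr ?_ fun e _ => rfl
    ext e
    rw [Finset.mem_filter, mem_edgesIn_iff_cutCount]
    simp
  rw [hin, ← Finset.sum_add_distrib]
  refine Finset.sum_congr rfl fun e _ => ?_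
  have h2 := cutCount_le_two U (e : Sym2 (Fin n))
  rcases Nat.lt_or_ge (cutCount U (e : Sym2 (Fin n))) 1 with h0 | h1
  · have h : cutCount U (e : Sym2 (Fin n)) = 0 := by omega
    simp [h]
  · rcases Nat.lt_or_ge (cutCount U (e : Sym2 (Fin n))) 2 with h1' | h2'
    · have h : cutCount U (e : Sym2 (Fin n)) = 1 := by omega
      simp [h]
    · have h : cutCount U (e : Sym2 (Fin n)) = 2 := by omega
      simp [h]

/-- **`Σ_v x(δ(v)) = 2 Σ_e x_e`** (every edge of `K_n` has two endpoints; the case `U = V` of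
`sum_degree_eq`). [cite: KorteVygen2018, Thm. 11.16 proof (p. 298)] -/
theorem sum_degree_univ (x : EKn n → ℝ) :
    ∑ v, ∑ e ∈ univ.filter (fun e : EKn n => v ∈ (e : Sym2 (Fin n))), x e = 2 * ∑ e, x e := by
  rw [sum_degree_eq_sum_cutCount, Finset.mul_sum]
  refine Finset.sum_congr rfl fun e _ => ?_
  have h : cutCount (univ : Finset (Fin n)) (e : Sym2 (Fin n)) = 2 :=
    (mem_edgesIn_iff_cutCount univ e).1 (by unfold edgesIn; simp)
  rw [h]
  norm_num

/-- For odd `|S|`, Edmonds' natural number `(|S| − 1)/2` is the real number `(|S| − 1)/2`. [folklore] -/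
private theorem cast_half_pred {S : Finset (Fin n)} (hS : Odd S.card) :
    (((S.card - 1) / 2 : ℕ) : ℝ) = ((S.card : ℝ) - 1) / 2 := by
  obtain ⟨r, hr⟩ := hS
  rw [hr]
  have h1 : (2 * r + 1 - 1) / 2 = r := by omega
  rw [h1]
  push_cast
  ring

/-! ### The face relation -/

/-- **`Σ_e x_e ≤ n/2` is valid on the matching polytope** (half the sum of the degree constraints),
so `{Σ_e x_e = n/2}` cuts out a FACE of `P_M(K_n)`. [cite: Rothvoss2017, §1 (PDF p. 4, L40)] -/
theorem sum_le_half_of_mem_edmondsPolytope {x : EKn n → ℝ}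
    (hx : x ∈ edmondsPolytope (⊤ : SimpleGraph (Fin n))) : ∑ e, x e ≤ (n : ℝ) / 2 := by
  have h := Finset.sum_le_sum fun v (_ : v ∈ (univ : Finset (Fin n))) => hx.2.1 v
  rw [sum_degree_univ, Finset.sum_const, Finset.card_univ, Fintype.card_fin, nsmul_eq_mul,
    mul_one] at h
  linarith

/-- **The perfect matching polytope is the face `{Σ_e x_e = n/2}` of the matching polytope**:
`P_PM(K_n) = P_M(K_n) ∩ {x | Σ_e x_e = n/2}` ("Since `P_PM` is a face of `P_M`"), for every `n`
(both sides are empty for odd `n`).  Proof from the two Edmonds descriptions (`mem_pmPolytope_iff`,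
`edmondsPolytope`): the degree equations give `Σ_e x_e = n/2` and, with `x(δ(U)) ≥ 1`,
`x(E(U)) = (|U| − x(δ(U)))/2 ≤ (|U|−1)/2`; conversely `Σ_e x_e = n/2` makes all `n` degree
constraints `x(δ(v)) ≤ 1` tight, and then `x(δ(U)) = |U| − 2x(E(U)) ≥ 1` for odd `U`.
[cite: Rothvoss2017, §1 (PDF p. 4, L33–40)] -/
theorem pmPolytope_eq_edmondsPolytope_inter (n : ℕ) :
    pmPolytope n =
      edmondsPolytope (⊤ : SimpleGraph (Fin n)) ∩ {x | ∑ e, x e = (n : ℝ) / 2} := by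
  ext x
  rw [mem_pmPolytope_iff]
  constructor
  · rintro ⟨h0, hdeg, hcut⟩
    have hdegU : ∀ U : Finset (Fin n),
        ∑ v ∈ U, ∑ e ∈ univ.filter (fun e : EKn n => v ∈ (e : Sym2 (Fin n))), x e = U.card := by
      intro U
      rw [Finset.sum_congr rfl fun v _ => hdeg v, Finset.sum_const, nsmul_eq_mul, mul_one]
    refine ⟨⟨h0, fun v => (hdeg v).le, fun S hS => ?_⟩, ?_⟩
    · -- blossom inequality from the odd cut inequality
      have h1 := sum_degree_eq x S
      rw [hdegU S] at h1
      have h2 := hcut S hS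
      rw [cast_half_pred hS]
      linarith
    · -- `Σ_e x_e = n/2`
      have h1 := sum_degree_univ x
      rw [hdegU univ, Finset.card_univ, Fintype.card_fin] at h1
      show ∑ e, x e = (n : ℝ) / 2
      linarith
  · rintro ⟨⟨h0, hdeg, hodd⟩, hsum⟩
    have hsum' : ∑ e, x e = (n : ℝ) / 2 := hsum
    -- all degree constraints are tight
    have htot : ∑ v, ∑ e ∈ univ.filter (fun e : EKn n => v ∈ (e : Sym2 (Fin n))), x e =
        ∑ _v : Fin n, (1 : ℝ) := by
      rw [sum_degree_univ, hsum', Finset.sum_const, Finset.card_univ, Fintype.card_fin,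
        nsmul_eq_mul, mul_one]
      ring
    have hdeg1 : ∀ v : Fin n, ∑ e ∈ univ.filter (fun e : EKn n => v ∈ (e : Sym2 (Fin n))), x e = 1 :=
      fun v => (Finset.sum_eq_sum_iff_of_le fun v _ => hdeg v).1 htot v (Finset.mem_univ v)
    refine ⟨h0, hdeg1, fun U hU => ?_⟩
    -- odd cut inequality from the blossom inequality
    have h1 := sum_degree_eq x U
    rw [Finset.sum_congr rfl fun v _ => hdeg1 v, Finset.sum_const, nsmul_eq_mul, mul_one] at h1
    have h2 := hodd U hU
    rw [cast_half_pred hU] at h2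
    linarith

/-- **"Since `P_PM` is a face of `P_M`, we have `xc(P_PM) ≤ xc(P_M)`"**: an extended formulation of
the matching polytope `P_M(K_n)` of size `r` yields one of the perfect matching polytope `P_PM(K_n)`
of size `r` (intersecting with the hyperplane of a valid inequality is free in the slack-form
currency, `HasEFOfSize.inter_eqs`). [cite: Rothvoss2017, §1 (PDF p. 4, L40)] -/
theorem HasEFOfSize.pmPolytope_of_edmondsPolytope {r : ℕ}
    (h : HasEFOfSize (edmondsPolytope (⊤ : SimpleGraph (Fin n))) r) :
    HasEFOfSize (pmPolytope n) r := by
  have h1 := h.inter_eqs (T := Unit) (fun _ => fun _ : EKn n => (1 : ℝ)) (fun _ => (n : ℝ) / 2)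
  rw [pmPolytope_eq_edmondsPolytope_inter]
  convert h1 using 2
  ext x
  simp only [Set.mem_setOf_eq, dotProduct, one_mul, forall_const]

/-- **The matching polytope has exponential extension complexity** (the title theorem, for the
matching polytope `P_M(K_n)` of all matchings): there is `c > 0` such that for all sufficiently
large EVEN `n`, every extended formulation of `P_M(K_n)` has at least `2^{cn}` inequalities —
Theorem 1 for `P_PM(K_n)` (`Rothvoss2017_thm1`) carried across the face.
[cite: Rothvoss2017, Thm. 1 and §1 (PDF p. 4, L40 and L51)] -/
theorem Rothvoss2017_thm1_matchingPolytope :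
    ∃ c : ℝ, 0 < c ∧ ∀ᶠ n : ℕ in atTop, Even n → ∀ r : ℕ,
      HasEFOfSize (edmondsPolytope (⊤ : SimpleGraph (Fin n))) r → (2 : ℝ) ^ (c * n) ≤ r := by
  obtain ⟨c, hc, hev⟩ := Rothvoss2017_thm1
  refine ⟨c, hc, ?_⟩
  filter_upwards [hev] with n hn he r hr
  exact hn he r hr.pmPolytope_of_edmondsPolytope

/-- The nonnegative-rank reading through the face: an extended formulation of `P_M(K_n)` of size
`r` gives a nonnegative factorisation of size `r + 1` of the odd-cut slack matrix
`S_{UM} = |δ(U) ∩ M| − 1` of the PERFECT matching polytope (Yannakakis,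
`hasNonnegFactorization_pmOddCutSlack_of_hasEF`). [cite: Rothvoss2017, Thm. 4 and §1 (PDF pp. 4–5)] -/
theorem hasNonnegFactorization_pmOddCutSlack_of_hasEF_edmondsPolytope {r : ℕ}
    (h : HasEFOfSize (edmondsPolytope (⊤ : SimpleGraph (Fin n))) r) :
    HasNonnegFactorization (pmOddCutSlack n) (r + 1) :=
  hasNonnegFactorization_pmOddCutSlack_of_hasEF h.pmPolytope_of_edmondsPolytope

/-! ### All large `n`: the matching polytope along a vertex embedding (appended)

For odd `n` one passes to `K_{n−1} ⊆ K_n`.  In the tree's currency this needs the transport of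
`edmondsPolytope` along an EMBEDDING of vertex types: for `f : V ↪ W` the graph `G.map f` on `W`
(Mathlib) is a copy of `G` plus `|W| − |V|` isolated vertices, and its matching polytope is the
copy of that of `G` (isolated vertices carry no coordinates; Edmonds' blossom inequality of an odd
`S ⊆ W` whose trace on `V` is even follows from the degree constraints).  [folklore; recorded for
Rothvoss2017, §1 (PDF p. 4) — "the matching polytope" for every `n`] -/

section MapTransport

variable {V W : Type} {G : SimpleGraph V} (f : V ↪ W)

/-- Every edge of `G.map f` is the image of an edge of `G`. [folklore] -/
private theorem mapEdgeSet_surjective :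
    Function.Surjective (SimpleGraph.Embedding.map f G).mapEdgeSet := by
  rintro ⟨e, he⟩
  induction e using Sym2.ind with
  | h u v =>
    have hadj : (G.map f).Adj u v := he
    rw [SimpleGraph.map_adj] at hadj
    obtain ⟨u', v', huv, rfl, rfl⟩ := hadj
    exact ⟨⟨s(u', v'), huv⟩, rfl⟩

/-- **The edge bijection `E(G) ≃ E(G.map f)`** of a vertex embedding (`e ↦ f(e)`).
[cite: Rothvoss2017, §1 (PDF p. 4)] -/
def mapEdgeEquiv : G.edgeSet ≃ (G.map f).edgeSet :=
  Equiv.ofBijective (SimpleGraph.Embedding.map f G).mapEdgeSet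
    ⟨(SimpleGraph.Embedding.map f G).mapEdgeSet.injective, mapEdgeSet_surjective f⟩

/-- The underlying pair of the image edge is `Sym2.map f`. [folklore] -/
private theorem coe_mapEdgeEquiv (e : G.edgeSet) :
    ((mapEdgeEquiv f e : (G.map f).edgeSet) : Sym2 W) = Sym2.map f (e : Sym2 V) :=
  rfl

/-- `v ∈ e ↔ f v ∈ f(e)`. [folklore] -/
private theorem mem_mapEdgeEquiv_iff (e : G.edgeSet) (v : V) :
    f v ∈ ((mapEdgeEquiv f e : (G.map f).edgeSet) : Sym2 W) ↔ v ∈ (e : Sym2 V) := by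
  rw [coe_mapEdgeEquiv, Sym2.mem_map]
  constructor
  · rintro ⟨a, ha, hfa⟩
    rwa [← f.injective hfa]
  · exact fun hv => ⟨v, hv, rfl⟩

/-- Vertices of `f(e)` are in the range of `f`. [folklore] -/
private theorem exists_eq_of_mem_mapEdgeEquiv (e : G.edgeSet) {w : W}
    (hw : w ∈ ((mapEdgeEquiv f e : (G.map f).edgeSet) : Sym2 W)) : ∃ v, v ∈ (e : Sym2 V) ∧ f v = w := by
  rw [coe_mapEdgeEquiv, Sym2.mem_map] at hw
  exact hw

variable [Fintype V] [DecidableEq V] [Fintype W] [DecidableEq W] [DecidableRel G.Adj]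
  [DecidableRel (G.map f).Adj]

/-- Degree sums correspond: `Σ_{e ∋ v} y(f(e)) = Σ_{e' ∋ f v} y(e')`. [folklore] -/
private theorem sum_degree_mapEdgeEquiv (y : (G.map f).edgeSet → ℝ) (v : V) :
    ∑ e ∈ univ.filter (fun e : G.edgeSet => v ∈ (e : Sym2 V)), y (mapEdgeEquiv f e) =
      ∑ e' ∈ univ.filter (fun e' : (G.map f).edgeSet => f v ∈ (e' : Sym2 W)), y e' := by
  refine Finset.sum_equiv (mapEdgeEquiv f) (fun e => ?_) (fun e _ => rfl)
  simp only [Finset.mem_filter, Finset.mem_univ, true_and, mem_mapEdgeEquiv_iff]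

omit [Fintype V] [DecidableEq V] [DecidableRel G.Adj] in
/-- No edge of `G.map f` meets a vertex outside the range of `f`. [folklore] -/
private theorem filter_mem_eq_empty_of_not_mem_range {w : W} (hw : w ∉ Set.range f) :
    univ.filter (fun e' : (G.map f).edgeSet => w ∈ (e' : Sym2 W)) = ∅ := by
  refine Finset.filter_eq_empty_iff.2 fun e' _ hwe => hw ?_
  obtain ⟨v, -, hv⟩ := exists_eq_of_mem_mapEdgeEquiv f ((mapEdgeEquiv f).symm e')
    (by rwa [Equiv.apply_symm_apply])
  exact ⟨v, hv⟩

/-- Inner edges correspond (image form): `e ∈ E(S) ↔ f(e) ∈ E(f(S))`. [folklore] -/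
private theorem mem_edgesIn_map_iff (S : Finset V) (e : G.edgeSet) :
    e ∈ edgesIn G S ↔ mapEdgeEquiv f e ∈ edgesIn (G.map f) (S.map f) := by
  simp only [edgesIn, Finset.mem_filter, Finset.mem_univ, true_and]
  constructor
  · intro h w hw
    obtain ⟨v, hv, rfl⟩ := exists_eq_of_mem_mapEdgeEquiv f e hw
    exact Finset.mem_map_of_mem f (h v hv)
  · intro h v hv
    have h1 := h (f v) ((mem_mapEdgeEquiv_iff f e v).2 hv)
    rw [Finset.mem_map' f] at h1
    exact h1

/-- Inner edges correspond (preimage form): `e ∈ E(f⁻¹(S')) ↔ f(e) ∈ E(S')`. [folklore] -/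
private theorem mem_edgesIn_preimage_iff (S' : Finset W) (e : G.edgeSet) :
    e ∈ edgesIn G (S'.preimage f f.injective.injOn) ↔ mapEdgeEquiv f e ∈ edgesIn (G.map f) S' := by
  simp only [edgesIn, Finset.mem_filter, Finset.mem_univ, true_and, Finset.mem_preimage]
  constructor
  · intro h w hw
    obtain ⟨v, hv, rfl⟩ := exists_eq_of_mem_mapEdgeEquiv f e hw
    exact h v hv
  · intro h v hv
    exact h (f v) ((mem_mapEdgeEquiv_iff f e v).2 hv)

/-- **The matching polytope of `G.map f` is the copy of that of `G`**: `y ∈ P_M(G.map f)` iff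
`y ∘ f ∈ P_M(G)` (coordinates identified along the edge bijection).  Edmonds' inequalities
correspond one-to-one, except (i) the degree constraints at the isolated vertices `W ∖ f(V)`, which
are empty sums, and (ii) the blossom inequalities of odd `S' ⊆ W` whose trace `f⁻¹(S')` is EVEN,
which follow from the degree constraints (`x(E(T)) ≤ |T|/2`, `sum_edgesIn_le_half_card`, and
`|T| ≤ |S'| − 1`). [cite: Rothvoss2017, §1 (PDF p. 4)] -/
theorem mem_edmondsPolytope_map_iff (y : (G.map f).edgeSet → ℝ) :
    y ∈ edmondsPolytope (G.map f) ↔ (fun e => y (mapEdgeEquiv f e)) ∈ edmondsPolytope G := by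
  constructor
  · rintro ⟨h0, hdeg, hodd⟩
    refine ⟨fun e => h0 _, fun v => ?_, fun S hS => ?_⟩
    · rw [sum_degree_mapEdgeEquiv]
      exact hdeg (f v)
    · rw [Finset.sum_equiv (mapEdgeEquiv f) (t := edgesIn (G.map f) (S.map f)) (g := y)
        (fun e => mem_edgesIn_map_iff f S e) (fun e _ => rfl)]
      have h1 := hodd (S.map f) (by rwa [Finset.card_map])
      rwa [Finset.card_map] at h1
  · rintro ⟨h0, hdeg, hodd⟩
    have h0' : ∀ e', 0 ≤ y e' := fun e' => by
      simpa only [Equiv.apply_symm_apply] using h0 ((mapEdgeEquiv f).symm e')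
    refine ⟨h0', fun w => ?_, fun S' hS' => ?_⟩
    · by_cases hw : w ∈ Set.range f
      · obtain ⟨v, rfl⟩ := hw
        rw [← sum_degree_mapEdgeEquiv]
        exact hdeg v
      · rw [filter_mem_eq_empty_of_not_mem_range f hw, Finset.sum_empty]
        exact zero_le_one
    · -- blossom inequality of `S'` from that of / the degree bound on `T = f⁻¹(S')`
      set T : Finset V := S'.preimage f f.injective.injOn with hT
      have hsum : ∑ e' ∈ edgesIn (G.map f) S', y e' =
          ∑ e ∈ edgesIn G T, y (mapEdgeEquiv f e) :=
        (Finset.sum_equiv (mapEdgeEquiv f) (t := edgesIn (G.map f) S') (g := y)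
          (fun e => mem_edgesIn_preimage_iff f S' e) (fun e _ => rfl)).symm
      rw [hsum]
      have hTle : T.card ≤ S'.card := by
        calc T.card = (T.map f).card := (Finset.card_map f).symm
          _ ≤ S'.card := Finset.card_le_card (Finset.map_subset_iff_subset_preimage.2 subset_rfl)
      rcases Nat.even_or_odd T.card with hTe | hTo
      · -- even trace: degree bound
        have h1 := sum_edgesIn_le_half_card h0 hdeg T
        have hlt : T.card + 1 ≤ S'.card := by
          rcases hTle.lt_or_eq with hlt | heq
          · omega
          · exfalso
            rw [heq] at hTe
            exact (Nat.not_even_iff_odd.2 hS') hTe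
        have hcast : ((T.card : ℝ)) / 2 ≤ (((S'.card - 1) / 2 : ℕ) : ℝ) := by
          obtain ⟨r, hr⟩ := hTe
          have h2 : T.card / 2 ≤ (S'.card - 1) / 2 := by omega
          have h3 : ((T.card : ℝ)) / 2 = ((T.card / 2 : ℕ) : ℝ) := by
            rw [hr]
            have : (r + r) / 2 = r := by omega
            rw [this]
            push_cast
            ring
          rw [h3]
          exact_mod_cast h2
        exact h1.trans hcast
      · -- odd trace: the blossom inequality of `T`, and monotonicity of `(k−1)/2`
        have h1 := hodd T hTo
        have h2 : (((T.card - 1) / 2 : ℕ) : ℝ) ≤ (((S'.card - 1) / 2 : ℕ) : ℝ) := by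
          have : (T.card - 1) / 2 ≤ (S'.card - 1) / 2 := by omega
          exact_mod_cast this
        exact h1.trans h2

/-- **`P_M(G.map f)` is the linear copy of `P_M(G)`** along the edge bijection.
[cite: Rothvoss2017, §1 (PDF p. 4)] -/
theorem edmondsPolytope_eq_image_map :
    edmondsPolytope G =
      (LinearMap.funLeft ℝ ℝ (mapEdgeEquiv f)) '' edmondsPolytope (G.map f) := by
  ext x
  simp only [Set.mem_image]
  constructor
  · intro hx
    refine ⟨fun e' => x ((mapEdgeEquiv f).symm e'), ?_, ?_⟩
    · rw [mem_edmondsPolytope_map_iff]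
      simpa only [Equiv.symm_apply_apply] using hx
    · funext e
      rw [LinearMap.funLeft_apply, Equiv.symm_apply_apply]
  · rintro ⟨y, hy, rfl⟩
    have h1 := (mem_edmondsPolytope_map_iff f y).1 hy
    exact h1

/-- **Extension complexity of the matching polytope is invariant under adding isolated vertices /
relabelling**: `xc(P_M(G)) ≤ r` iff `xc(P_M(G.map f)) ≤ r`. [cite: Rothvoss2017, §1 (PDF p. 4)] -/
theorem hasEFOfSize_edmondsPolytope_map_iff {r : ℕ} :
    HasEFOfSize (edmondsPolytope (G.map f)) r ↔ HasEFOfSize (edmondsPolytope G) r := by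
  constructor
  · intro h
    rw [edmondsPolytope_eq_image_map f]
    exact h.image_linearMap _
  · intro h
    have h1 := h.image_linearMap (LinearMap.funLeft ℝ ℝ (mapEdgeEquiv f).symm)
    convert h1 using 1
    ext y
    simp only [Set.mem_image]
    constructor
    · intro hy
      refine ⟨fun e => y (mapEdgeEquiv f e), (mem_edmondsPolytope_map_iff f y).1 hy, ?_⟩
      funext e'
      rw [LinearMap.funLeft_apply, Equiv.apply_symm_apply]
    · rintro ⟨x, hx, rfl⟩
      rw [mem_edmondsPolytope_map_iff]
      have : (fun e => (LinearMap.funLeft ℝ ℝ (mapEdgeEquiv f).symm) x (mapEdgeEquiv f e)) = x := by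
        funext e
        rw [LinearMap.funLeft_apply, Equiv.symm_apply_apply]
      rw [this]
      exact hx

end MapTransport

/-! ### The title theorem for every large `n` -/

/-- `K_m` embedded in `K_{m+1}` (the last vertex isolated) is a subgraph of `K_{m+1}`. [folklore] -/
private theorem map_top_castSucc_le (m : ℕ) :
    (⊤ : SimpleGraph (Fin m)).map Fin.castSuccEmb ≤ (⊤ : SimpleGraph (Fin (m + 1))) :=
  le_top

/-- **From `K_{m+1}` to `K_m`**: an extended formulation of `P_M(K_{m+1})` of size `r` gives one
of `P_M(K_m)` of size `r` (restrict to the subgraph `K_m + ` isolated vertex, then relabel).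
[cite: Rothvoss2017, §1 (PDF p. 4)] -/
theorem hasEFOfSize_edmondsPolytope_top_of_succ {m r : ℕ}
    (h : HasEFOfSize (edmondsPolytope (⊤ : SimpleGraph (Fin (m + 1)))) r) :
    HasEFOfSize (edmondsPolytope (⊤ : SimpleGraph (Fin m))) r := by
  classical
  have h1 := hasEFOfSize_edmondsPolytope_of_subgraph (map_top_castSucc_le m) h
  exact (hasEFOfSize_edmondsPolytope_map_iff (G := (⊤ : SimpleGraph (Fin m))) Fin.castSuccEmb).1 h1

/-- **The matching polytope has exponential extension complexity, for every large `n`** (even or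
odd): there is `c > 0` such that eventually every extended formulation of `P_M(K_n)` has at least
`2^{cn}` inequalities.  Even `n`: `Rothvoss2017_thm1_matchingPolytope`; odd `n = m + 1`: the
bound `2^{c m} ≥ 2^{(c/2) n}` for `K_m ⊆ K_n` (`hasEFOfSize_edmondsPolytope_top_of_succ`).
[cite: Rothvoss2017, Thm. 1 and §1 (PDF p. 4)] -/
theorem Rothvoss2017_thm1_matchingPolytope_all :
    ∃ c : ℝ, 0 < c ∧ ∀ᶠ n : ℕ in atTop, ∀ r : ℕ,
      HasEFOfSize (edmondsPolytope (⊤ : SimpleGraph (Fin n))) r → (2 : ℝ) ^ (c * n) ≤ r := by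
  obtain ⟨c, hc, hev⟩ := Rothvoss2017_thm1_matchingPolytope
  obtain ⟨N, hN⟩ := eventually_atTop.1 hev
  refine ⟨c / 2, by positivity, eventually_atTop.2 ⟨N + 2, fun n hn r hr => ?_⟩⟩
  have hmono : ∀ {a b : ℝ}, a ≤ b → (2 : ℝ) ^ a ≤ (2 : ℝ) ^ b := fun hab =>
    Real.rpow_le_rpow_of_exponent_le (by norm_num) hab
  rcases Nat.even_or_odd n with he | ho
  · have h1 := hN n (by omega) he r hr
    refine le_trans (hmono ?_) h1
    have : (0 : ℝ) ≤ n := Nat.cast_nonneg n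
    nlinarith
  · obtain ⟨m, rfl⟩ : ∃ m, n = m + 1 := ⟨n - 1, by omega⟩
    have hme : Even m := by
      obtain ⟨k, hk⟩ := ho
      exact ⟨k, by omega⟩
    have h1 := hN m (by omega) hme r (hasEFOfSize_edmondsPolytope_top_of_succ hr)
    refine le_trans (hmono ?_) h1
    have hm1 : (1 : ℝ) ≤ m := by exact_mod_cast (show 1 ≤ m by omega)
    push_cast
    nlinarith

/-! ### Semidefinite versions (appended): faces and vertex embeddings are free for psd lifts -/

section Psd

/-- **A psd lift of the matching polytope restricts to the perfect matching polytope at no cost**: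
`P_PM(K_n) = P_M(K_n) ∩ {Σ_e x_e = n/2}` is an affine section, and affine sections add equations to
the affine space of a psd lift (GPT 2013 Prop. 2.8 (3), the tree's `HasPsdLift.inter_setOf_apply_eq`).
So a lower bound on the size of psd lifts of `P_PM(K_n)` is one for `P_M(K_n)`.
[cite: Rothvoss2017, §1 (PDF p. 4, L40) and §4.2 (PDF p. 13)] [cite: GouveiaParriloThomas2013, Prop. 2.8 (3) (§2, p06)] -/
theorem hasPsdLift_pmPolytope_of_edmondsPolytope {k : ℕ}
    (h : HasPsdLift (edmondsPolytope (⊤ : SimpleGraph (Fin n))) k) : HasPsdLift (pmPolytope n) k := by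
  let φ : (EKn n → ℝ) →ₗ[ℝ] ℝ :=
    { toFun := fun x => ∑ e, x e
      map_add' := fun x y => by simp only [Pi.add_apply, Finset.sum_add_distrib]
      map_smul' := fun c x => by
        simp only [Pi.smul_apply, smul_eq_mul, RingHom.id_apply, Finset.mul_sum] }
  have h1 := h.inter_setOf_apply_eq φ ((n : ℝ) / 2)
  rw [pmPolytope_eq_edmondsPolytope_inter]
  exact h1

variable {V W : Type} [Fintype V] [DecidableEq V] [Fintype W] [DecidableEq W]
  {G : SimpleGraph V} [DecidableRel G.Adj] (f : V ↪ W) [DecidableRel (G.map f).Adj]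

/-- `P_M(G.map f)` is the linear copy of `P_M(G)` (the inverse direction of
`edmondsPolytope_eq_image_map`). [cite: Rothvoss2017, §1 (PDF p. 4)] -/
theorem edmondsPolytope_map_eq_image :
    edmondsPolytope (G.map f) =
      (LinearMap.funLeft ℝ ℝ (mapEdgeEquiv f).symm) '' edmondsPolytope G := by
  ext y
  simp only [Set.mem_image]
  constructor
  · intro hy
    refine ⟨fun e => y (mapEdgeEquiv f e), (mem_edmondsPolytope_map_iff f y).1 hy, ?_⟩
    funext e'
    rw [LinearMap.funLeft_apply, Equiv.apply_symm_apply]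
  · rintro ⟨x, hx, rfl⟩
    rw [mem_edmondsPolytope_map_iff]
    have h1 : (fun e => (LinearMap.funLeft ℝ ℝ (mapEdgeEquiv f).symm) x (mapEdgeEquiv f e)) = x := by
      funext e
      rw [LinearMap.funLeft_apply, Equiv.symm_apply_apply]
    rw [h1]
    exact hx

/-- **Psd lifts of the matching polytope are invariant under vertex embeddings** (adding isolated
vertices / relabelling): `P_M(G.map f)` has a psd lift of size `k` iff `P_M(G)` does (linear images
are free, GRT Lemma 3.3 = `HasPsdLift.image`). [cite: Rothvoss2017, §1 (PDF p. 4)] [cite: GouveiaRobinsonThomas2015, Lemma 3.3 (p07)] -/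
theorem hasPsdLift_edmondsPolytope_map_iff {k : ℕ} :
    HasPsdLift (edmondsPolytope (G.map f)) k ↔ HasPsdLift (edmondsPolytope G) k := by
  constructor
  · intro h
    rw [edmondsPolytope_eq_image_map f]
    exact h.image _
  · intro h
    rw [edmondsPolytope_map_eq_image f]
    exact h.image _

end Psd

/-! ### From `K_N` down to `K_n` and to `P_PM(K_n)`, `n ≤ N` -/

/-- **`K_m ⊆ K_{m+1}`, psd form**: a psd lift of `P_M(K_{m+1})` of size `k` gives one of `P_M(K_m)`.
[cite: Rothvoss2017, §1 (PDF p. 4) and §4.2 (PDF p. 13)] -/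
theorem hasPsdLift_edmondsPolytope_top_of_succ {m k : ℕ}
    (h : HasPsdLift (edmondsPolytope (⊤ : SimpleGraph (Fin (m + 1)))) k) :
    HasPsdLift (edmondsPolytope (⊤ : SimpleGraph (Fin m))) k := by
  classical
  have h1 := hasPsdLift_edmondsPolytope_of_subgraph (map_top_castSucc_le m) h
  exact (hasPsdLift_edmondsPolytope_map_iff (G := (⊤ : SimpleGraph (Fin m))) Fin.castSuccEmb).1 h1

/-- **`K_m ⊆ K_N` for `m ≤ N`, psd form.** [cite: Rothvoss2017, §1 (PDF p. 4) and §4.2 (PDF p. 13)] -/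
theorem hasPsdLift_edmondsPolytope_top_of_le {m N k : ℕ} (hmN : m ≤ N)
    (h : HasPsdLift (edmondsPolytope (⊤ : SimpleGraph (Fin N))) k) :
    HasPsdLift (edmondsPolytope (⊤ : SimpleGraph (Fin m))) k := by
  obtain ⟨d, rfl⟩ := Nat.exists_eq_add_of_le hmN
  induction d with
  | zero => simpa using h
  | succ d ih =>
    exact ih (Nat.le_add_right m d) (hasPsdLift_edmondsPolytope_top_of_succ (by
      simpa only [Nat.add_succ] using h))

/-- **`K_m ⊆ K_N` for `m ≤ N`, LP form.** [cite: Rothvoss2017, §1 (PDF p. 4)] -/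
theorem hasEFOfSize_edmondsPolytope_top_of_le {m N r : ℕ} (hmN : m ≤ N)
    (h : HasEFOfSize (edmondsPolytope (⊤ : SimpleGraph (Fin N))) r) :
    HasEFOfSize (edmondsPolytope (⊤ : SimpleGraph (Fin m))) r := by
  obtain ⟨d, rfl⟩ := Nat.exists_eq_add_of_le hmN
  induction d with
  | zero => simpa using h
  | succ d ih =>
    exact ih (Nat.le_add_right m d) (hasEFOfSize_edmondsPolytope_top_of_succ (by
      simpa only [Nat.add_succ] using h))

/-- **Lower bounds for the perfect matching polytope propagate to all larger matching polytopes
(semidefinite form)**: a psd lift of size `k` of `P_M(K_N)` yields one of `P_PM(K_n)` for every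
`n ≤ N` (restrict to `K_n ⊆ K_N`, then to the face `P_PM(K_n)`).  Contrapositively, if `P_PM(K_n)`
has no psd lift of size `k`, then neither has `P_M(K_N)` for any `N ≥ n` — the matching-polytope
form of any answer, for `P_PM`, to the printed open question "whether matching polytopes also have high
semidefinite extension complexity" [FawziEtAl2020, §6]. [cite: Rothvoss2017, §1 (PDF p. 4, L40) and §4.2 (PDF p. 13)]
[cite: FawziEtAl2020, §6 Discussion, ¶ "Lower bounds for spectrahedral lifts" (arXiv:2002.09788, p0030 L47–48)] -/
theorem hasPsdLift_pmPolytope_of_edmondsPolytope_ge {n N k : ℕ} (hnN : n ≤ N)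
    (h : HasPsdLift (edmondsPolytope (⊤ : SimpleGraph (Fin N))) k) : HasPsdLift (pmPolytope n) k :=
  hasPsdLift_pmPolytope_of_edmondsPolytope (hasPsdLift_edmondsPolytope_top_of_le hnN h)

/-- The LP form of the same propagation: an extended formulation of `P_M(K_N)` of size `r` yields one
of `P_PM(K_n)` for every `n ≤ N`. [cite: Rothvoss2017, §1 (PDF p. 4, L40)] -/
theorem hasEFOfSize_pmPolytope_of_edmondsPolytope_ge {n N r : ℕ} (hnN : n ≤ N)
    (h : HasEFOfSize (edmondsPolytope (⊤ : SimpleGraph (Fin N))) r) : HasEFOfSize (pmPolytope n) r :=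
  (hasEFOfSize_edmondsPolytope_top_of_le hnN h).pmPolytope_of_edmondsPolytope

end Literature.Barriers.PneNP

end
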